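import Summits.NavierStokesRegularity.OSWSelfSimilar.SheetNSLineTorusCascadeLinkCertified
import Summits.NavierStokesRegularity.OSWSelfSimilar.SheetNSLineTorusCascadeSuperTail
import HarnessLib

/-!
# Viscous CLM on the torus (`a = 0`, `σ = 2`): the AGGREGATE WINDOW CHAIN — Duhamel window lower bounds with time-dependent
# accumulation, and a tail induction in which the low modes enter only through two antidiagonal SUMS

HONEST FRAMING (cell ns-blowup GROUP B «PROFILE SEARCH», zone Z3, row Z3-U addendum A-F2 of `HOME/profile/z3/CENSUS-Z3.md`;
human rulings D-0035/D-0074; Z3-TWIN lineage): **1-D MODEL (viscous Constantin–Lax–Majda equation `ω_t = ω Hω + ν ω_xx` on `𝕋`);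
ODE calculus on Fourier-coefficient families, kernel-checked; not Euler, not Navier–Stokes; «violates: none — MODEL».**

OBJECT: the sine-datum cascade `IsSineCascade ν c e` (`SheetNSLineTorusCascade`): `ė_k = ½ Σ_{i+j=k} e_i e_j − νk² e_k`, `e_k ≥ 0`.
The static head/tail certificates (`SheetNSLineTorusCascadeTailStatic`, `…KernelTwentyFour`: `c ≥ 24ν` ⇒ blow-up, datum-free) ask
EVERY head mode to dominate ONE static family `A j λ^j (1 − ζ_j)` on the whole window; their binding constraint is mode `1` at the
window end (`E_1(log 2) = 1/2`), not the size of the heads, which already sit on the double pole near `t*` (`(12j/E_j(t))^{1/j}`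
is flat in `j ≥ 3`). HERE the comparison is AGGREGATE:

* `antidiagonal_conv_mono` — termwise domination of the convolution by any nonnegative comparison vector vanishing at `0`;
* `duhamel_window_lb` — **the Duhamel window bound with accumulation**: if `Φ ≤ ½Σ_{i+j=k} e_i e_j` on `[t₀, T]` then
  `Φ (1 − e^{−νk²(t−t₀)})/(νk²) ≤ e_k(t)` for every `t ∈ [t₀, T]` (zero start at `t₀`; the factor grows with `t`); `univ_duhamel_window_lb`
  (the universal family `E = cascadeSolution 1 (sineDatum 1)`), `accum_lb` (rational read-out of the accumulation factor on a later cell: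
  `e^{−k²(s − log q)} ≤ (q/w)^n` for `s ≥ log w`, `n ≤ k²`), `exp_neg_le_inv_of_log_le` / `inv_le_exp_neg_of_le_log` (cell ends);
* `mul_ge_neg_of_bounds` (`−δ ≤ x, y ≤ Δ`, `0 ≤ δ` ⇒ `−(δΔ) ≤ xy`), `antidiagonal_sum_snd_mul`
  (`Σ_{i+j=k} j·d_i = k Σ_{i≤K} d_i − Σ_{i≤K} i d_i` when `d` vanishes above `K < k`);
* `tail_induction_aggregate` — **THE AGGREGATE TAIL INDUCTION.** Let `K₁ ≥ 1`, `A, λ > 0`, `0 ≤ T₁`, `0 < L`, `e^{−L} ≤ ε < 1`, and a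
  perturbation `d : ℕ → ℝ` with `d_0 = 0`, `d_j = 0` for `j > K₁`, `−δ ≤ d_j ≤ Δ` (`δ ≥ 0`), `A j + d_j ≥ 0`, such that the modes
  `1 ≤ j ≤ K₁` satisfy `(A j + d_j) λ^j ≤ e_j(s)` on `[T₁, T]`; let `D₀ ≤ Σ_{j≤K₁} d_j`, `Σ_{j≤K₁} j d_j ≤ D₁`. If the cubic
  `p(k) = (1−ε)[A²(k³−k)/6 + 2A(kD₀ − D₁) − (k+1)δΔ] − 2νAk³` satisfies `12ν ≤ (1−ε)A`, `p(K₁+1) ≥ 0` and the increment condition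
  `(3(K₁+1)² + 3(K₁+1))((1−ε)A²/6 − 2νA) + (1−ε)(2AD₀ − δΔ) − 2νA ≥ 0`, then **every mode `k > K₁` satisfies `A k λ^k ≤ e_k(t)` on
  `[T₁ + (L/ν)(1/K₁ − 1/k), T]`** (telescoping windows `L/(νk(k−1))`; the low modes enter ONLY through `D₀`, `D₁`, `δ`, `Δ` —
  a surplus of one mode pays for the deficit of another); `family_lower_bound_at` (all `k > K₁` at every `t ∈ [T₁ + L/(νK₁), T]`);
* `unbounded_of_universal_family` — if the universal family has `A k λ₁^k ≤ E_k(s)` for `k > K₁`, `s ∈ [T₂, T]`, then for EVERY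
  `ν > 0`, `c` with `λ₁ c ≥ ν` and EVERY sine cascade `e` with parameters `(ν, c)`: `k ↦ e_k(t)` is unbounded at every
  `t ∈ [T₂/ν, T/ν]`; `horizon_lt_of_universal_family` (PDE level via eng-3's `horizon_lt_of_cascade_unbounded`: no classical
  `2π`-periodic solution of the MODEL PDE from `−c sin x`, `λ₁ c ≥ ν`, exists on `[0, T₂/ν]`); `datum_lt_of_classicalSolution_family`.
USE (instances, generated from the exact closed forms `univ_*_ge`): a rational schedule `log q_{k₀} < log q_{k₀+1} < … < log q_{K₁} ≤ T`,
one `univ_duhamel_window_lb` per mode `k₀ < k ≤ K₁` fed by per-cell rational product sums, then `tail_induction_aggregate` from `K₁`.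
bears_on: LADDER-NS N5 / zone Z3 (row Z3-U) → N1 linear core. WHAT THIS IS NOT: not NS; no number certified by THIS file; no definitions.
-/

namespace Summit.NavierStokesRegularity.OSWSelfSimilar
namespace SheetNSLineTorusCascade

open Finset Real Set

variable {ν c : ℝ} {e : ℕ → ℝ → ℝ}

/-! ### Termwise domination of the convolution -/

/-- If `m_0 = 0 = f_0`, `0 ≤ m_i` for `i < k` and `m_i ≤ f_i` for `1 ≤ i < k`, then `Σ_{i+j=k} m_i m_j ≤ Σ_{i+j=k} f_i f_j`
(the two terms through the index `k` vanish on both sides). [folklore] -/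
theorem antidiagonal_conv_mono {m f : ℕ → ℝ} (k : ℕ) (hm0 : m 0 = 0) (hf0 : f 0 = 0)
    (hmnn : ∀ i, i < k → 0 ≤ m i) (hmf : ∀ i, 1 ≤ i → i < k → m i ≤ f i) :
    ∑ p ∈ antidiagonal k, m p.1 * m p.2 ≤ ∑ p ∈ antidiagonal k, f p.1 * f p.2 := by
  refine sum_le_sum fun p hp => ?_
  have hsum : p.1 + p.2 = k := mem_antidiagonal.mp hp
  rcases Nat.eq_zero_or_pos p.1 with h1 | h1
  · rw [h1, hm0, hf0, zero_mul, zero_mul]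
  rcases Nat.eq_zero_or_pos p.2 with h2 | h2
  · rw [h2, hm0, hf0, mul_zero, mul_zero]
  exact mul_le_mul (hmf p.1 h1 (by omega)) (hmf p.2 h2 (by omega)) (hmnn p.2 (by omega))
    (le_trans (hmnn p.1 (by omega)) (hmf p.1 h1 (by omega)))

/-! ### The Duhamel window bound with accumulation -/

/-- **DUHAMEL WINDOW LOWER BOUND (time-dependent accumulation).** Let `k ≥ 1`, `0 ≤ t₀`, and suppose the convolution driving
mode `k` is bounded below by the constant `Φ` on `[t₀, T]`: `Φ ≤ ½ Σ_{i+j=k} e_i(s) e_j(s)`. Then for every `t ∈ [t₀, T]`,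
`Φ (1 − e^{−νk²(t − t₀)})/(νk²) ≤ e_k(t)` (zero start at `t₀`: `e^{νk²s} e_k(s) − Φ e^{νk²s}/(νk²)` is non-decreasing and
`e_k(t₀) ≥ 0`). [new here — MODEL] -/
theorem duhamel_window_lb (he : IsSineCascade ν c e) (hν : 0 < ν) (hc : 0 ≤ c) {k : ℕ} (hk : 1 ≤ k)
    {t₀ T Φ : ℝ} (ht₀ : 0 ≤ t₀)
    (hΦ : ∀ s ∈ Icc t₀ T, Φ ≤ (1 / 2) * ∑ p ∈ antidiagonal k, e p.1 s * e p.2 s) :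
    ∀ t ∈ Icc t₀ T, Φ * (1 - exp (-(ν * (k : ℝ) ^ 2 * (t - t₀)))) / (ν * (k : ℝ) ^ 2) ≤ e k t := by
  intro t ht
  have hkpos : (0 : ℝ) < k := by exact_mod_cast hk
  have hκ : 0 < ν * (k : ℝ) ^ 2 := by positivity
  have hκ0 : ν * (k : ℝ) ^ 2 ≠ 0 := hκ.ne'
  set D : ℝ → ℝ := fun s => exp (ν * (k : ℝ) ^ 2 * s) * e k s with hD
  set G : ℝ → ℝ := fun s => Φ * exp (ν * (k : ℝ) ^ 2 * s) / (ν * (k : ℝ) ^ 2) with hG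
  have hG' : ∀ s, HasDerivAt G (Φ * (exp (ν * (k : ℝ) ^ 2 * s) * (ν * (k : ℝ) ^ 2)) / (ν * (k : ℝ) ^ 2)) s := by
    intro s
    have := ((((hasDerivAt_id s).const_mul (ν * (k : ℝ) ^ 2)).exp.const_mul Φ).div_const (ν * (k : ℝ) ^ 2))
    simpa using this
  have hGcont : Continuous G :=
    (continuous_const.mul (continuous_exp.comp (continuous_const.mul continuous_id))).div_const _
  have hmono : MonotoneOn (fun s => D s - G s) (Icc t₀ T) := by
    refine monotoneOn_of_hasDerivWithinAt_nonneg
      (f' := fun s => exp (ν * (k : ℝ) ^ 2 * s) * ((1 / 2) * ∑ p ∈ antidiagonal k, e p.1 s * e p.2 s)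
        - Φ * (exp (ν * (k : ℝ) ^ 2 * s) * (ν * (k : ℝ) ^ 2)) / (ν * (k : ℝ) ^ 2))
      (convex_Icc t₀ T) ?_ (fun s hs => ?_) (fun s hs => ?_)
    · exact ((continuousOn_weighted he k).mono fun s hs => (le_trans ht₀ hs.1 : (0 : ℝ) ≤ s)).sub hGcont.continuousOn
    · rw [interior_Icc] at hs ⊢
      exact ((hasDerivAt_weighted he k (lt_of_le_of_lt ht₀ hs.1)).sub (hG' s)).hasDerivWithinAt
    · rw [interior_Icc] at hs
      have hΦs := hΦ s ⟨hs.1.le, hs.2.le⟩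
      have hid : Φ * (exp (ν * (k : ℝ) ^ 2 * s) * (ν * (k : ℝ) ^ 2)) / (ν * (k : ℝ) ^ 2)
          = exp (ν * (k : ℝ) ^ 2 * s) * Φ := by
        field_simp
      rw [hid, ← mul_sub]
      exact mul_nonneg (exp_pos _).le (by linarith)
  have hDt₀ : 0 ≤ D t₀ := mul_nonneg (exp_pos _).le (nonneg he hc k t₀ ht₀)
  have hmain : G t - G t₀ ≤ D t := by
    have hmem₀ : t₀ ∈ Icc t₀ T := ⟨le_rfl, le_trans ht.1 ht.2⟩
    have := hmono hmem₀ ht ht.1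
    simp only at this
    linarith
  have e1 : exp (-(ν * (k : ℝ) ^ 2 * t)) * exp (ν * (k : ℝ) ^ 2 * t) = 1 := by
    rw [← exp_add]; simp
  have e2 : exp (-(ν * (k : ℝ) ^ 2 * t)) * exp (ν * (k : ℝ) ^ 2 * t₀) = exp (-(ν * (k : ℝ) ^ 2 * (t - t₀))) := by
    rw [← exp_add]; congr 1; ring
  have hGt : exp (-(ν * (k : ℝ) ^ 2 * t)) * (G t - G t₀)
      = Φ * (1 - exp (-(ν * (k : ℝ) ^ 2 * (t - t₀)))) / (ν * (k : ℝ) ^ 2) := by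
    have step : exp (-(ν * (k : ℝ) ^ 2 * t)) * (G t - G t₀)
        = Φ / (ν * (k : ℝ) ^ 2) * (exp (-(ν * (k : ℝ) ^ 2 * t)) * exp (ν * (k : ℝ) ^ 2 * t)
          - exp (-(ν * (k : ℝ) ^ 2 * t)) * exp (ν * (k : ℝ) ^ 2 * t₀)) := by
      simp only [hG]; ring
    rw [step, e1, e2]
    ring
  have hekt : exp (-(ν * (k : ℝ) ^ 2 * t)) * D t = e k t := by
    simp only [hD]
    rw [← mul_assoc, e1, one_mul]
  calc Φ * (1 - exp (-(ν * (k : ℝ) ^ 2 * (t - t₀)))) / (ν * (k : ℝ) ^ 2)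
      = exp (-(ν * (k : ℝ) ^ 2 * t)) * (G t - G t₀) := hGt.symm
    _ ≤ exp (-(ν * (k : ℝ) ^ 2 * t)) * D t := mul_le_mul_of_nonneg_left hmain (exp_pos _).le
    _ = e k t := hekt

/-- The universal family `E = cascadeSolution 1 (sineDatum 1)` (`ν = c = 1`): if `Φ ≤ ½ Σ_{i+j=k} E_i E_j` on `[t₀, T]` (`t₀ ≥ 0`,
`k ≥ 1`) then `Φ (1 − e^{−k²(t − t₀)})/k² ≤ E_k(t)` for `t ∈ [t₀, T]`. [new here — MODEL] -/
theorem univ_duhamel_window_lb {k : ℕ} (hk : 1 ≤ k) {t₀ T Φ : ℝ} (ht₀ : 0 ≤ t₀)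
    (hΦ : ∀ s ∈ Icc t₀ T, Φ ≤ (1 / 2) * ∑ p ∈ antidiagonal k,
      cascadeSolution 1 (sineDatum 1) p.1 s * cascadeSolution 1 (sineDatum 1) p.2 s) :
    ∀ t ∈ Icc t₀ T, Φ * (1 - exp (-((k : ℝ) ^ 2 * (t - t₀)))) / (k : ℝ) ^ 2 ≤ cascadeSolution 1 (sineDatum 1) k t := by
  intro t ht
  have h := duhamel_window_lb (isSineCascade_cascadeSolution 1 1) one_pos zero_le_one hk ht₀ hΦ t ht
  simpa only [one_mul] using h

/-! ### Rational read-outs on cells `[log w, log w′]` -/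

/-- On `s ≥ log w` (`w > 0`): `e^{−s} ≤ 1/w`. [folklore] -/
theorem exp_neg_le_inv_of_log_le {s w : ℝ} (hw : 0 < w) (h : Real.log w ≤ s) : exp (-s) ≤ 1 / w := by
  have : exp (-s) ≤ exp (-Real.log w) := exp_le_exp.mpr (neg_le_neg h)
  rw [Real.exp_neg (Real.log w), exp_log hw] at this
  rw [one_div]; exact this

/-- On `s ≤ log w` (`w > 0`): `1/w ≤ e^{−s}`. [folklore] -/
theorem inv_le_exp_neg_of_le_log {s w : ℝ} (hw : 0 < w) (h : s ≤ Real.log w) : 1 / w ≤ exp (-s) := by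
  have : exp (-Real.log w) ≤ exp (-s) := exp_le_exp.mpr (neg_le_neg h)
  rw [Real.exp_neg (Real.log w), exp_log hw] at this
  rw [one_div]; exact this

/-- The accumulation factor read on a later cell: for `0 < q ≤ w`, `s ≥ log w` and `n ≤ k²`,
`e^{−k²(s − log q)} ≤ (q/w)^n`. [folklore] -/
theorem exp_neg_sq_mul_le_pow {s q w : ℝ} (k n : ℕ) (hn : n ≤ k ^ 2) (hq : 0 < q) (hqw : q ≤ w)
    (hs : Real.log w ≤ s) : exp (-((k : ℝ) ^ 2 * (s - Real.log q))) ≤ (q / w) ^ n := by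
  have hw : 0 < w := lt_of_lt_of_le hq hqw
  have hbase : exp (-(s - Real.log q)) ≤ q / w := by
    have h1 : exp (-(s - Real.log q)) = q * exp (-s) := by
      rw [show -(s - Real.log q) = Real.log q + -s by ring, exp_add, exp_log hq]
    rw [h1, div_eq_mul_one_div]
    exact mul_le_mul_of_nonneg_left (exp_neg_le_inv_of_log_le hw hs) hq.le
  have hle1 : q / w ≤ 1 := by rw [div_le_one hw]; exact hqw
  have hpow : exp (-((k : ℝ) ^ 2 * (s - Real.log q))) = exp (-(s - Real.log q)) ^ (k ^ 2) := by
    rw [← exp_nat_mul]; congr 1; push_cast; ring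
  rw [hpow]
  calc exp (-(s - Real.log q)) ^ (k ^ 2) ≤ (q / w) ^ (k ^ 2) := pow_le_pow_left₀ (exp_pos _).le hbase _
    _ ≤ (q / w) ^ n := pow_le_pow_of_le_one (div_nonneg hq.le hw.le) hle1 hn

/-- **Rational read-out of an accumulated window bound.** If `r ≤ Φ (1 − (q/w)^n)/k²` with `Φ ≥ 0`, `0 < q ≤ w`, `n ≤ k²`, then on
`s ≥ log w`: `r ≤ Φ (1 − e^{−k²(s − log q)})/k²` — so a `univ_duhamel_window_lb` bound started at `log q` reads as the constant `r` on
every cell beginning at `log w`. [folklore] -/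
theorem accum_lb {s q w Φ r : ℝ} (k n : ℕ) (hn : n ≤ k ^ 2) (hq : 0 < q) (hqw : q ≤ w)
    (hs : Real.log w ≤ s) (hΦ : 0 ≤ Φ) (hr : r ≤ Φ * (1 - (q / w) ^ n) / (k : ℝ) ^ 2) :
    r ≤ Φ * (1 - exp (-((k : ℝ) ^ 2 * (s - Real.log q)))) / (k : ℝ) ^ 2 := by
  refine le_trans hr ?_
  have h := exp_neg_sq_mul_le_pow k n hn hq hqw hs
  have hk2 : 0 ≤ (k : ℝ) ^ 2 := by positivity
  exact div_le_div_of_nonneg_right (mul_le_mul_of_nonneg_left (by linarith) hΦ) hk2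

/-! ### Two elementary pieces of the aggregate step -/

/-- `−δ ≤ x ≤ Δ`, `−δ ≤ y ≤ Δ`, `0 ≤ δ`, `0 ≤ Δ` ⇒ `−(δΔ) ≤ xy`. [folklore] -/
theorem mul_ge_neg_of_bounds {x y δ Δ : ℝ} (hδ : 0 ≤ δ) (hΔ : 0 ≤ Δ) (hx1 : -δ ≤ x) (hx2 : x ≤ Δ)
    (hy1 : -δ ≤ y) (hy2 : y ≤ Δ) : -(δ * Δ) ≤ x * y := by
  have hδΔ : 0 ≤ δ * Δ := mul_nonneg hδ hΔ
  rcases le_or_gt 0 x with hx | hx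
  · rcases le_or_gt 0 y with hy | hy
    · nlinarith [mul_nonneg hx hy]
    · nlinarith [mul_le_mul_of_nonneg_left hy1 hx]
  · rcases le_or_gt 0 y with hy | hy
    · nlinarith [mul_le_mul_of_nonneg_left hx1 hy]
    · nlinarith [mul_pos_of_neg_of_neg hx hy]

/-- `Σ_{(i,j), i+j=k} j·d_i = k Σ_{i≤K} d_i − Σ_{i≤K} i d_i` when `d_i = 0` for `i > K` and `K < k`. [folklore] -/
theorem antidiagonal_sum_snd_mul {d : ℕ → ℝ} {K k : ℕ} (hdK : ∀ j, K < j → d j = 0) (hKk : K < k) :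
    ∑ p ∈ antidiagonal k, (p.2 : ℝ) * d p.1
      = (k : ℝ) * ∑ i ∈ range (K + 1), d i - ∑ i ∈ range (K + 1), (i : ℝ) * d i := by
  rw [Nat.sum_antidiagonal_eq_sum_range_succ (fun i j => (j : ℝ) * d i) k]
  -- restrict the range sum to `i ≤ K`
  have hsub : range (K + 1) ⊆ range (k + 1) := range_subset_range.mpr (by omega)
  rw [← sum_subset hsub ?_]
  · rw [mul_sum, ← sum_sub_distrib]
    refine sum_congr rfl fun i hi => ?_
    rw [Finset.mem_range] at hi
    have hik : i ≤ k := by omega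
    rw [Nat.cast_sub hik]
    ring
  · intro i hi hiK
    rw [Finset.mem_range] at hi hiK
    rw [hdK i (by omega), mul_zero]


/-! ### Piecewise Duhamel with carry (appended, eng-5 g12) -/

/-- **DUHAMEL WINDOW BOUND WITH CARRY.** As `duhamel_window_lb`, keeping the initial value: if `ℓ ≤ e_k(t₀)` and
`Φ ≤ ½ Σ_{i+j=k} e_i e_j` on `[t₀, T]` (`k ≥ 1`, `t₀ ≥ 0`), then for every `t ∈ [t₀, T]`,
`e^{−νk²(t−t₀)} ℓ + Φ (1 − e^{−νk²(t−t₀)})/(νk²) ≤ e_k(t)`. [new here — MODEL] -/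
theorem duhamel_window_lb_carry (he : IsSineCascade ν c e) (hν : 0 < ν) {k : ℕ} (hk : 1 ≤ k)
    {t₀ T Φ ℓ : ℝ} (ht₀ : 0 ≤ t₀) (hℓ : ℓ ≤ e k t₀)
    (hΦ : ∀ s ∈ Icc t₀ T, Φ ≤ (1 / 2) * ∑ p ∈ antidiagonal k, e p.1 s * e p.2 s) :
    ∀ t ∈ Icc t₀ T, exp (-(ν * (k : ℝ) ^ 2 * (t - t₀))) * ℓ
      + Φ * (1 - exp (-(ν * (k : ℝ) ^ 2 * (t - t₀)))) / (ν * (k : ℝ) ^ 2) ≤ e k t := by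
  intro t ht
  have hkpos : (0 : ℝ) < k := by exact_mod_cast hk
  have hκ : 0 < ν * (k : ℝ) ^ 2 := by positivity
  have hκ0 : ν * (k : ℝ) ^ 2 ≠ 0 := hκ.ne'
  set D : ℝ → ℝ := fun s => exp (ν * (k : ℝ) ^ 2 * s) * e k s with hD
  set G : ℝ → ℝ := fun s => Φ * exp (ν * (k : ℝ) ^ 2 * s) / (ν * (k : ℝ) ^ 2) with hG
  have hG' : ∀ s, HasDerivAt G (Φ * (exp (ν * (k : ℝ) ^ 2 * s) * (ν * (k : ℝ) ^ 2)) / (ν * (k : ℝ) ^ 2)) s := by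
    intro s
    have := ((((hasDerivAt_id s).const_mul (ν * (k : ℝ) ^ 2)).exp.const_mul Φ).div_const (ν * (k : ℝ) ^ 2))
    simpa using this
  have hGcont : Continuous G :=
    (continuous_const.mul (continuous_exp.comp (continuous_const.mul continuous_id))).div_const _
  have hmono : MonotoneOn (fun s => D s - G s) (Icc t₀ T) := by
    refine monotoneOn_of_hasDerivWithinAt_nonneg
      (f' := fun s => exp (ν * (k : ℝ) ^ 2 * s) * ((1 / 2) * ∑ p ∈ antidiagonal k, e p.1 s * e p.2 s)
        - Φ * (exp (ν * (k : ℝ) ^ 2 * s) * (ν * (k : ℝ) ^ 2)) / (ν * (k : ℝ) ^ 2))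
      (convex_Icc t₀ T) ?_ (fun s hs => ?_) (fun s hs => ?_)
    · exact ((continuousOn_weighted he k).mono fun s hs => (le_trans ht₀ hs.1 : (0 : ℝ) ≤ s)).sub hGcont.continuousOn
    · rw [interior_Icc] at hs ⊢
      exact ((hasDerivAt_weighted he k (lt_of_le_of_lt ht₀ hs.1)).sub (hG' s)).hasDerivWithinAt
    · rw [interior_Icc] at hs
      have hΦs := hΦ s ⟨hs.1.le, hs.2.le⟩
      have hid : Φ * (exp (ν * (k : ℝ) ^ 2 * s) * (ν * (k : ℝ) ^ 2)) / (ν * (k : ℝ) ^ 2)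
          = exp (ν * (k : ℝ) ^ 2 * s) * Φ := by
        field_simp
      rw [hid, ← mul_sub]
      exact mul_nonneg (exp_pos _).le (by linarith)
  have hmain : G t - G t₀ + D t₀ ≤ D t := by
    have hmem₀ : t₀ ∈ Icc t₀ T := ⟨le_rfl, le_trans ht.1 ht.2⟩
    have := hmono hmem₀ ht ht.1
    simp only at this
    linarith
  have e1 : exp (-(ν * (k : ℝ) ^ 2 * t)) * exp (ν * (k : ℝ) ^ 2 * t) = 1 := by
    rw [← exp_add]; simp
  have e2 : exp (-(ν * (k : ℝ) ^ 2 * t)) * exp (ν * (k : ℝ) ^ 2 * t₀) = exp (-(ν * (k : ℝ) ^ 2 * (t - t₀))) := by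
    rw [← exp_add]; congr 1; ring
  have hGt : exp (-(ν * (k : ℝ) ^ 2 * t)) * (G t - G t₀ + D t₀)
      = exp (-(ν * (k : ℝ) ^ 2 * (t - t₀))) * e k t₀
        + Φ * (1 - exp (-(ν * (k : ℝ) ^ 2 * (t - t₀)))) / (ν * (k : ℝ) ^ 2) := by
    have step : exp (-(ν * (k : ℝ) ^ 2 * t)) * (G t - G t₀ + D t₀)
        = Φ / (ν * (k : ℝ) ^ 2) * (exp (-(ν * (k : ℝ) ^ 2 * t)) * exp (ν * (k : ℝ) ^ 2 * t)
          - exp (-(ν * (k : ℝ) ^ 2 * t)) * exp (ν * (k : ℝ) ^ 2 * t₀))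
          + (exp (-(ν * (k : ℝ) ^ 2 * t)) * exp (ν * (k : ℝ) ^ 2 * t₀)) * e k t₀ := by
      simp only [hG, hD]; ring
    rw [step, e1, e2]
    ring
  have hekt : exp (-(ν * (k : ℝ) ^ 2 * t)) * D t = e k t := by
    simp only [hD]
    rw [← mul_assoc, e1, one_mul]
  have hw0 : 0 ≤ exp (-(ν * (k : ℝ) ^ 2 * (t - t₀))) := (exp_pos _).le
  calc exp (-(ν * (k : ℝ) ^ 2 * (t - t₀))) * ℓ + Φ * (1 - exp (-(ν * (k : ℝ) ^ 2 * (t - t₀)))) / (ν * (k : ℝ) ^ 2)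
      ≤ exp (-(ν * (k : ℝ) ^ 2 * (t - t₀))) * e k t₀
        + Φ * (1 - exp (-(ν * (k : ℝ) ^ 2 * (t - t₀)))) / (ν * (k : ℝ) ^ 2) := by
        have := mul_le_mul_of_nonneg_left hℓ hw0
        linarith
    _ = exp (-(ν * (k : ℝ) ^ 2 * t)) * (G t - G t₀ + D t₀) := hGt.symm
    _ ≤ exp (-(ν * (k : ℝ) ^ 2 * t)) * D t := mul_le_mul_of_nonneg_left hmain (exp_pos _).le
    _ = e k t := hekt

/-- **In-cell read-out (convex combination).** Under the hypotheses of `duhamel_window_lb_carry`: on `[t₀, T]`,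
`min ℓ (Φ/(νk²)) ≤ e_k(s)` — the weight `e^{−νk²(s−t₀)}` lies in `[0, 1]`. [new here — MODEL] -/
theorem duhamel_cell_min_lb (he : IsSineCascade ν c e) (hν : 0 < ν) {k : ℕ} (hk : 1 ≤ k)
    {t₀ T Φ ℓ : ℝ} (ht₀ : 0 ≤ t₀) (hℓ : ℓ ≤ e k t₀)
    (hΦ : ∀ s ∈ Icc t₀ T, Φ ≤ (1 / 2) * ∑ p ∈ antidiagonal k, e p.1 s * e p.2 s) :
    ∀ s ∈ Icc t₀ T, min ℓ (Φ / (ν * (k : ℝ) ^ 2)) ≤ e k s := by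
  intro s hs
  have h := duhamel_window_lb_carry he hν hk ht₀ hℓ hΦ s hs
  have hkpos : (0 : ℝ) < k := by exact_mod_cast hk
  have hκ : 0 < ν * (k : ℝ) ^ 2 := by positivity
  set w : ℝ := exp (-(ν * (k : ℝ) ^ 2 * (s - t₀))) with hw
  have hw0 : 0 ≤ w := (exp_pos _).le
  have hw1 : w ≤ 1 := by
    rw [hw, exp_le_one_iff]
    have : 0 ≤ ν * (k : ℝ) ^ 2 * (s - t₀) := mul_nonneg hκ.le (by linarith [hs.1])
    linarith
  have hm1 : min ℓ (Φ / (ν * (k : ℝ) ^ 2)) ≤ ℓ := min_le_left _ _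
  have hm2 : min ℓ (Φ / (ν * (k : ℝ) ^ 2)) ≤ Φ / (ν * (k : ℝ) ^ 2) := min_le_right _ _
  have hid : w * ℓ + Φ * (1 - w) / (ν * (k : ℝ) ^ 2) = w * ℓ + (1 - w) * (Φ / (ν * (k : ℝ) ^ 2)) := by ring
  rw [hid] at h
  nlinarith [mul_le_mul_of_nonneg_left hm1 hw0, mul_le_mul_of_nonneg_left hm2 (by linarith : (0 : ℝ) ≤ 1 - w)]

/-- **Cell-end read-out, rising branch.** Under the hypotheses of `duhamel_window_lb_carry` with `ℓ ≤ Φ/(νk²)` and any `r` with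
`e^{−νk²(t−t₀)} ≤ r`: `ℓ + (1 − r)(Φ/(νk²) − ℓ) ≤ e_k(t)`. (Falling branch `ℓ > Φ/(νk²)`: use `duhamel_cell_min_lb`, i.e. `Φ/(νk²)`.)
[new here — MODEL] -/
theorem duhamel_cell_end_lb (he : IsSineCascade ν c e) (hν : 0 < ν) {k : ℕ} (hk : 1 ≤ k)
    {t₀ T Φ ℓ r : ℝ} (ht₀ : 0 ≤ t₀) (hℓ : ℓ ≤ e k t₀) (hℓΦ : ℓ ≤ Φ / (ν * (k : ℝ) ^ 2))
    (hΦ : ∀ s ∈ Icc t₀ T, Φ ≤ (1 / 2) * ∑ p ∈ antidiagonal k, e p.1 s * e p.2 s)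
    {t : ℝ} (ht : t ∈ Icc t₀ T) (hr : exp (-(ν * (k : ℝ) ^ 2 * (t - t₀))) ≤ r) :
    ℓ + (1 - r) * (Φ / (ν * (k : ℝ) ^ 2) - ℓ) ≤ e k t := by
  have h := duhamel_window_lb_carry he hν hk ht₀ hℓ hΦ t ht
  have hid : exp (-(ν * (k : ℝ) ^ 2 * (t - t₀))) * ℓ + Φ * (1 - exp (-(ν * (k : ℝ) ^ 2 * (t - t₀)))) / (ν * (k : ℝ) ^ 2)
      = ℓ + (1 - exp (-(ν * (k : ℝ) ^ 2 * (t - t₀)))) * (Φ / (ν * (k : ℝ) ^ 2) - ℓ) := by ring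
  rw [hid] at h
  have hd : 0 ≤ Φ / (ν * (k : ℝ) ^ 2) - ℓ := by linarith
  nlinarith [mul_le_mul_of_nonneg_right hr hd]

/-- The universal family (`ν = 1`), rising-branch cell step with the rational weight bound of `exp_neg_sq_mul_le_pow`: if `ℓ ≤ E_k(log q)`,
`ℓ ≤ Φ/k²`, `Φ ≤ ½ΣE_iE_j` on `[log q, log w]` (`0 < q ≤ w`, `1 ≤ q`), `n ≤ k²` and `r' ≤ ℓ + (1 − (q/w)^n)(Φ/k² − ℓ)`, then `r' ≤ E_k(log w)`.
[new here — MODEL] -/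
theorem univ_cell_step {k n : ℕ} (hk : 1 ≤ k) (hn : n ≤ k ^ 2) {q w Φ ℓ r' : ℝ} (hq : 1 ≤ q) (hqw : q ≤ w)
    (hℓ : ℓ ≤ cascadeSolution 1 (sineDatum 1) k (Real.log q)) (hℓΦ : ℓ ≤ Φ / (k : ℝ) ^ 2)
    (hΦ : ∀ s ∈ Icc (Real.log q) (Real.log w), Φ ≤ (1 / 2) * ∑ p ∈ antidiagonal k,
      cascadeSolution 1 (sineDatum 1) p.1 s * cascadeSolution 1 (sineDatum 1) p.2 s)
    (hr' : r' ≤ ℓ + (1 - (q / w) ^ n) * (Φ / (k : ℝ) ^ 2 - ℓ)) :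
    r' ≤ cascadeSolution 1 (sineDatum 1) k (Real.log w) := by
  have hq0 : 0 < q := lt_of_lt_of_le one_pos hq
  have hw0 : 0 < w := lt_of_lt_of_le hq0 hqw
  have ht₀ : 0 ≤ Real.log q := Real.log_nonneg hq
  have hlog : Real.log q ≤ Real.log w := Real.log_le_log hq0 hqw
  have hℓΦ' : ℓ ≤ Φ / (1 * (k : ℝ) ^ 2) := by rw [one_mul]; exact hℓΦ
  have hr : exp (-(1 * (k : ℝ) ^ 2 * (Real.log w - Real.log q))) ≤ (q / w) ^ n := by
    rw [one_mul]; exact exp_neg_sq_mul_le_pow k n hn hq0 hqw le_rfl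
  have h := duhamel_cell_end_lb (isSineCascade_cascadeSolution 1 1) one_pos hk ht₀ hℓ hℓΦ' hΦ ⟨hlog, le_rfl⟩ hr
  rw [one_mul] at h
  have hd : 0 ≤ Φ / (k : ℝ) ^ 2 - ℓ := by linarith
  have hle1 : (q / w) ^ n ≤ 1 := pow_le_one₀ (div_nonneg hq0.le hw0.le) (by rw [div_le_one hw0]; exact hqw)
  linarith [h, hr']

/-- The universal family (`ν = 1`), in-cell read-out: if `ℓ ≤ E_k(log q)` and `Φ ≤ ½ΣE_iE_j` on `[log q, log w]` (`1 ≤ q`), then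
`min ℓ (Φ/k²) ≤ E_k(s)` for every `s ∈ [log q, log w]`. [new here — MODEL] -/
theorem univ_cell_min {k : ℕ} (hk : 1 ≤ k) {q w Φ ℓ : ℝ} (hq : 1 ≤ q)
    (hℓ : ℓ ≤ cascadeSolution 1 (sineDatum 1) k (Real.log q))
    (hΦ : ∀ s ∈ Icc (Real.log q) (Real.log w), Φ ≤ (1 / 2) * ∑ p ∈ antidiagonal k,
      cascadeSolution 1 (sineDatum 1) p.1 s * cascadeSolution 1 (sineDatum 1) p.2 s) :
    ∀ s ∈ Icc (Real.log q) (Real.log w), min ℓ (Φ / (k : ℝ) ^ 2) ≤ cascadeSolution 1 (sineDatum 1) k s := by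
  intro s hs
  have h := duhamel_cell_min_lb (isSineCascade_cascadeSolution 1 1) one_pos hk (Real.log_nonneg hq) hℓ hΦ s hs
  rwa [one_mul] at h

end SheetNSLineTorusCascade
end Summit.NavierStokesRegularity.OSWSelfSimilar
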